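import Mathlib
import Literature.NumberTheory.GaloisRepresentations.IntegralGaloisAction

/-!
# The cubic residue symbol `(·/𝔭)₃` of `ℤ[ω]` and the Picard trace

Source: K. Ireland, M. Rosen, *A Classical Introduction to Modern Number Theory* (GTM 84, Springer
1982), Ch. 9 §3 "Cubic residue character": Prop. 9.3.1 (`α^{Nπ-1} ≡ 1 (π)`), Prop. 9.3.2 (for
`Nπ ≠ 3` and `π ∤ α` there is a unique `m ∈ {0, 1, 2}` with `α^{(Nπ-1)/3} ≡ ω^m (π)`), the
Definition following it (`(α/π)₃ = 0` if `π ∣ α`; otherwise `(α/π)₃` is the element of `{1, ω, ω²}`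
with `α^{(Nπ-1)/3} ≡ (α/π)₃ (π)`), Prop. 9.3.3 (b)–(d) (congruence, multiplicativity, dependence on
`α mod π` only) — bib key `IrelandRosen1982`; and Ch. 8 §1 Prop. 8.1.5 (`N(xⁿ = a) = Σ_{χⁿ = ε} χ(a)`)
for the point count behind `picardTrace`.

## Contents
* `cubicResidueSymbol 𝔭 : 𝓞 K ⧸ 𝔭 → 𝓞 K` for a finite place `𝔭 : HeightOneSpectrum (𝓞 K)` of a
  number field `K` — designed for `K = ℚ(ω) = CyclotomicField 3 ℚ`, `𝓞 K = ℤ[ω]`, and stated for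
  any number field (it is the intended object whenever `ω ∈ K`). It is defined WITHOUT choosing a
  primitive cube root of unity: the sum over all `μ ∈ 𝓞 K` with `μ³ = 1` of
  `μ · [μ ≡ a^{(N𝔭-1)/3} (mod 𝔭)]`, where `N𝔭 = 𝔭.residueCard = #(𝓞 K ⧸ 𝔭)`.
* Independence of the choice of `ω` = the inlined form used by the route
  `Summits/Langlands/Langlands/Theses/PicardBranchPoint`: for every `ζ : 𝓞 K` with `ζ² + ζ + 1 = 0`,
  `Σ_{j<3} (if ζ^j ≡ a^{(N𝔭-1)/3} (mod 𝔭) then ζ^j else 0) = cubicResidueSymbol 𝔭 a`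
  (`sum_range_ite_eq_cubicResidueSymbol`, `cubicResidueSymbol_eq_sum_range`), and
  `isPrimitiveRoot_three_iff : IsPrimitiveRoot ζ 3 ↔ ζ² + ζ + 1 = 0`.
* Ireland–Rosen's characterisation and the basic API. All of it takes a primitive cube root
  `hζ : IsPrimitiveRoot ζ 3` in `𝓞 K` as an explicit hypothesis (only its EXISTENCE matters for the
  `ζ`-free statements; for `ℚ(ω)` it is supplied by `exists_isPrimitiveRoot_three` /
  `exists_isPrimitiveRoot_three_cyclotomicField`, and the route quantifies over such `ζ` anyway):
  `cubicResidueSymbol_spec` / `cubicResidueSymbol_eq_iff` (for `𝔭 ∤ 3`, `a ≠ 0`: `χ_𝔭(a)` is THE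
  cube root of unity `≡ a^{(N𝔭-1)/3}`), `cubicResidueSymbol_zero`, `cubicResidueSymbol_one`,
  `cubicResidueSymbol_mul` (Prop. 9.3.3 (c)), `cubicResidueSymbol_mem` (values in `{0, 1, ζ, ζ²}`),
  `cubicResidueSymbol_sub_one_mem_span` (`χ_𝔭(a) ≡ 1 (mod 1 - ζ)` for `a ≠ 0`),
  `cubicResidueSymbol_of_three_mem` (the junk value `0` at `𝔭 ∣ 3`),
  `three_dvd_residueCard_sub_one` (`3 ∣ N𝔭 - 1` for `𝔭 ∤ 3`), complex conjugation
  `starRingEnd_map_cubicResidueSymbol` (Prop. 9.3.4 (a): `conj χ = χ² = χ(a²)`), and the packaging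
  `cubicResidueChar hζ 𝔭 h3 : MulChar (𝓞 K ⧸ 𝔭) (𝓞 K)` for `𝔭 ∤ 3` with `cubicResidueChar_pow_three`.
* `embedding_eq_or_conjugate_eq` / `embedding_apply_eq_starRingEnd_of_ne`: `ℚ(ω)` has one infinite
  place, so the values of the two complex embeddings are complex conjugate.
* `picardTrace f 𝔭 = -Σ_{x ∈ 𝓞 K ⧸ 𝔭} χ_𝔭(f̄(x))` for `f ∈ ℤ[X]` (the cubic character sum of the
  Picard curve `y³ = f(x)`), its `Fintype` form, its inlined form
  `neg_finsum_sum_range_ite_eq_picardTrace`, and the branch-point congruence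
  `picardTrace_sub_card_roots_sub_one_mem_span`:
  `a_𝔭(f) ≡ #{x : f̄(x) = 0} - 1 (mod 1 - ζ)` for `𝔭 ∤ 3`, `f̄ ≠ 0`.

## Design / junk values
Ireland–Rosen define `(α/π)₃` only for `Nπ ≠ 3`. If `𝔭 ∣ 3` then `ζ ≡ 1 (mod 𝔭)` for every cube
root of unity `ζ`, so the three summands share one condition and the symbol equals
`[1 ≡ a^{(N𝔭-1)/3}] · (1 + ζ + ζ²) = 0`: `cubicResidueSymbol 𝔭` and `picardTrace · 𝔭` vanish
identically at the prime above `3` — the same junk value as the route's inlined expression.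
`(N𝔭 - 1) / 3` is natural-number division; for `𝔭 ∤ 3` it is exact (`three_dvd_residueCard_sub_one`).
The `if`s in the bridging lemmas are stated over an arbitrary family of `Decidable` instances so
that they rewrite the route's (classical) terms. We do NOT key the API on the class
`IsCyclotomicExtension {3} ℚ K`: at `K = CyclotomicField 3 ℚ` instance search for it meets the
`Algebra ℚ _` diamond (`DivisionRing.toRatAlgebra` vs the splitting-field algebra) in this toolchain,
whereas an explicit `hζ` is diamond-free and is exactly what the route provides.

## Not here
Prop. 9.3.3 (a) (`χ_𝔭(a) = 1 ↔ a` is a cube mod `𝔭`), Prop. 9.3.4 (b) (`χ_{π̄}(ᾱ) = conj χ_π(α)`),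
primary primes and cubic reciprocity (Ch. 9 §§4–6), Jacobi sums and the Lefschetz evaluation
`#C(𝔽_q) = q + 1 + S_χ + S_χ̄` of the Picard curve (Holzapfel; Upton 2009): `picardTrace` is only the
elementary character sum `-S_χ`.
-/

namespace Literature.NumberTheory.GaloisRepresentations

open NumberField IsDedekindDomain Polynomial

variable {K : Type*} [Field K] [NumberField K]

/-- The **cubic residue symbol** `χ_𝔭 = (·/𝔭)₃` at a finite place `𝔭` of a number field `K`
(intended for `K ∋ ω`, e.g. `K = ℚ(ω)`, `𝓞 K = ℤ[ω]`), as a function on the residue ring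
`𝓞 K ⧸ 𝔭` with values in `𝓞 K`:
`χ_𝔭(a) = Σ_{μ ∈ 𝓞 K, μ³ = 1} (if μ ≡ a^{(N𝔭-1)/3} (mod 𝔭) then μ else 0)`, `N𝔭 = #(𝓞 K ⧸ 𝔭)`.
For `𝔭 ∤ 3` the cube roots of unity `1, ω, ω²` are pairwise incongruent mod `𝔭`, `3 ∣ N𝔭 - 1`, and
for `a ≠ 0` exactly one of them is `≡ a^{(N𝔭-1)/3}`, so `χ_𝔭(a)` is the unique cube root of unity
congruent to `a^{(N𝔭-1)/3}` modulo `𝔭` (Ireland–Rosen, Prop. 9.3.2 and the Definition after it,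
part (b)), while `χ_𝔭(0) = 0` (part (a)); see `cubicResidueSymbol_eq_iff`, `cubicResidueSymbol_zero`.
Junk value: for `𝔭 ∣ 3` (`N𝔭 = 3`, where Ireland–Rosen leave the symbol undefined) every cube root
of unity is `≡ 1 (mod 𝔭)` and the sum is `1 + ω + ω² = 0`, so `χ_𝔭 = 0` identically
(`cubicResidueSymbol_of_three_mem`).
[cite: IrelandRosen1982, Ch. 9 §3, Definition after Prop. 9.3.2] -/
noncomputable def cubicResidueSymbol (𝔭 : HeightOneSpectrum (𝓞 K)) (a : 𝓞 K ⧸ 𝔭.asIdeal) : 𝓞 K :=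
  haveI := Classical.decEq (𝓞 K ⧸ 𝔭.asIdeal)
  ∑ μ ∈ nthRootsFinset 3 (1 : 𝓞 K),
    if Ideal.Quotient.mk 𝔭.asIdeal μ = a ^ ((𝔭.residueCard - 1) / 3) then μ else 0

/-! ### Primitive cube roots of unity in `𝓞 K` -/

/-- A root of `X² + X + 1` in `𝓞 K` is a primitive cube root of unity (this is how the route
`PicardBranchPoint` quantifies over `ω`). [folklore] -/
theorem isPrimitiveRoot_of_sq_add_self_add_one {ζ : 𝓞 K} (h : ζ ^ 2 + ζ + 1 = 0) :
    IsPrimitiveRoot ζ 3 := by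
  have h3 : ζ ^ 3 = 1 := by linear_combination (ζ - 1) * h
  have h1 : ζ ≠ 1 := by
    rintro rfl
    norm_num at h
  exact orderOf_eq_prime h3 h1 ▸ IsPrimitiveRoot.orderOf ζ

omit [NumberField K] in
/-- A primitive cube root of unity in `𝓞 K` is a root of `X² + X + 1`. [folklore] -/
theorem sq_add_self_add_one_eq_zero {ζ : 𝓞 K} (hζ : IsPrimitiveRoot ζ 3) : ζ ^ 2 + ζ + 1 = 0 := by
  have h := hζ.geom_sum_eq_zero (by norm_num : 1 < 3)
  simp only [Finset.sum_range_succ, Finset.sum_range_zero, zero_add, pow_zero, pow_one] at h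
  linear_combination h

/-- `IsPrimitiveRoot ζ 3 ↔ ζ² + ζ + 1 = 0` in `𝓞 K` (the route's way of saying "`ζ` is a primitive
cube root of unity"). [folklore] -/
theorem isPrimitiveRoot_three_iff {ζ : 𝓞 K} : IsPrimitiveRoot ζ 3 ↔ ζ ^ 2 + ζ + 1 = 0 :=
  ⟨sq_add_self_add_one_eq_zero, isPrimitiveRoot_of_sq_add_self_add_one⟩

/-- `𝓞 K` contains a primitive cube root of unity when `K = ℚ(ω)` abstractly
(`IsCyclotomicExtension {3} ℚ K` as a hypothesis): the integer `(zeta 3 ℚ K).toInteger`. [folklore] -/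
theorem exists_isPrimitiveRoot_three [IsCyclotomicExtension {3} ℚ K] :
    ∃ ζ : 𝓞 K, IsPrimitiveRoot ζ 3 :=
  ⟨(IsCyclotomicExtension.zeta_spec 3 ℚ K).toInteger,
    (IsCyclotomicExtension.zeta_spec 3 ℚ K).toInteger_isPrimitiveRoot⟩

/-- `ℤ[ω] = 𝓞 (CyclotomicField 3 ℚ)` contains a primitive cube root of unity (the concrete field of
route `PicardBranchPoint`; the `IsCyclotomicExtension` instance is supplied by hand to sidestep the
`Algebra ℚ _` instance diamond). [folklore] -/
theorem exists_isPrimitiveRoot_three_cyclotomicField :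
    ∃ ζ : 𝓞 (CyclotomicField 3 ℚ), IsPrimitiveRoot ζ 3 :=
  haveI : IsCyclotomicExtension {3} ℚ (CyclotomicField 3 ℚ) :=
    CyclotomicField.isCyclotomicExtension 3 ℚ
  exists_isPrimitiveRoot_three

section IsPrimitiveRoot

/-! ### The symbol, given a primitive cube root `ζ ∈ 𝓞 K` -/

variable {ζ : 𝓞 K} (hζ : IsPrimitiveRoot ζ 3)
include hζ

omit [NumberField K] in
/-- The cube roots of unity of `𝓞 K` are `1, ζ, ζ²` (`𝓞 K` is a domain). [folklore] -/
theorem nthRootsFinset_three_eq_image [DecidableEq (𝓞 K)] :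
    nthRootsFinset 3 (1 : 𝓞 K) = (Finset.range 3).image (ζ ^ ·) := by
  rw [nthRootsFinset_def, hζ.nthRoots_eq (one_pow 3), Multiset.toFinset_map, ← Finset.range_val,
    Finset.val_toFinset]
  simp only [mul_one]

/-- **Independence of the choice of `ω`, expanded form.** For any primitive cube root of unity
`ζ ∈ 𝓞 K`, `χ_𝔭(a) = Σ_{j < 3} (if ζ^j ≡ a^{(N𝔭-1)/3} (mod 𝔭) then ζ^j else 0)` — the expression
inlined by the route `PicardBranchPoint` (any family of `Decidable` instances). [folklore] -/
theorem cubicResidueSymbol_eq_sum_range (𝔭 : HeightOneSpectrum (𝓞 K)) (a : 𝓞 K ⧸ 𝔭.asIdeal)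
    [∀ j : ℕ, Decidable (Ideal.Quotient.mk 𝔭.asIdeal (ζ ^ j) = a ^ ((𝔭.residueCard - 1) / 3))] :
    cubicResidueSymbol 𝔭 a = ∑ j ∈ Finset.range 3,
      (if Ideal.Quotient.mk 𝔭.asIdeal (ζ ^ j) = a ^ ((𝔭.residueCard - 1) / 3) then ζ ^ j else 0) := by
  classical
  unfold cubicResidueSymbol
  rw [nthRootsFinset_three_eq_image hζ, Finset.sum_image fun i hi j hj h =>
    hζ.pow_inj (Finset.mem_range.1 hi) (Finset.mem_range.1 hj) h]
  refine Finset.sum_congr rfl fun j _ => ?_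
  split_ifs <;> rfl

omit [NumberField K] in
/-- `(1 - ζ)² = -3ζ` for a primitive cube root of unity. [folklore] -/
theorem one_sub_sq_eq_neg_three_mul : (1 - ζ) ^ 2 = -3 * ζ := by
  linear_combination sq_add_self_add_one_eq_zero hζ

omit [NumberField K] in
/-- `3 ∈ (1 - ζ)`: indeed `3 = (1 - ζ)² · (-ζ²)`. [folklore] -/
theorem three_mem_span_one_sub : (3 : 𝓞 K) ∈ Ideal.span {1 - ζ} := by
  have hq := sq_add_self_add_one_eq_zero hζ
  rw [Ideal.mem_span_singleton]
  exact ⟨(1 - ζ) * (-ζ ^ 2), by linear_combination (ζ ^ 2 - 3 * ζ + 3) * hq⟩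

omit [NumberField K] in
/-- For a prime `𝔭` of `𝓞 K`: `3 ∈ 𝔭 ↔ 1 - ζ ∈ 𝔭` (as `(1 - ζ)² = -3ζ` and `3 = (1 - ζ)² · (-ζ²)`).
This is Ireland–Rosen's "`Nπ ≠ 3 ⇔ π` not associate to `1 - ω`" in ideal form. [folklore] -/
theorem three_mem_iff_one_sub_mem (𝔭 : HeightOneSpectrum (𝓞 K)) :
    (3 : 𝓞 K) ∈ 𝔭.asIdeal ↔ 1 - ζ ∈ 𝔭.asIdeal := by
  have hq := sq_add_self_add_one_eq_zero hζ
  constructor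
  · intro h3
    refine 𝔭.isPrime.mem_of_pow_mem 2 ?_
    rw [one_sub_sq_eq_neg_three_mul hζ]
    exact 𝔭.asIdeal.mul_mem_right ζ (𝔭.asIdeal.neg_mem_iff.2 h3)
  · intro h1
    have h : (3 : 𝓞 K) = (1 - ζ) * ((1 - ζ) * (-ζ ^ 2)) := by
      linear_combination (ζ ^ 2 - 3 * ζ + 3) * hq
    rw [h]
    exact 𝔭.asIdeal.mul_mem_right _ h1

omit [NumberField K] in
/-- `ζ ≡ 1 (mod 𝔭) ↔ 𝔭 ∣ 3`. [folklore] -/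
theorem mk_eq_one_iff_three_mem (𝔭 : HeightOneSpectrum (𝓞 K)) :
    Ideal.Quotient.mk 𝔭.asIdeal ζ = 1 ↔ (3 : 𝓞 K) ∈ 𝔭.asIdeal := by
  rw [three_mem_iff_one_sub_mem hζ, ← (Ideal.Quotient.mk 𝔭.asIdeal).map_one, eq_comm,
    Ideal.Quotient.eq]

omit [NumberField K] in
/-- For `𝔭 ∤ 3` the reduction of `ζ` is a primitive cube root of unity of the residue field
(Ireland–Rosen, Ch. 9 §3: "the residue classes of `1, ω, ω²` are distinct").
[cite: IrelandRosen1982, Ch. 9 §3, remark before Prop. 9.3.2] -/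
theorem isPrimitiveRoot_mk_of_three_not_mem {𝔭 : HeightOneSpectrum (𝓞 K)}
    (h3 : (3 : 𝓞 K) ∉ 𝔭.asIdeal) : IsPrimitiveRoot (Ideal.Quotient.mk 𝔭.asIdeal ζ) 3 := by
  have h1 : Ideal.Quotient.mk 𝔭.asIdeal ζ ≠ 1 := fun h => h3 ((mk_eq_one_iff_three_mem hζ 𝔭).1 h)
  have hcube : Ideal.Quotient.mk 𝔭.asIdeal ζ ^ 3 = 1 := by rw [← map_pow, hζ.pow_eq_one, map_one]
  exact orderOf_eq_prime hcube h1 ▸ IsPrimitiveRoot.orderOf _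

/-- `3 ∣ N𝔭 - 1` for `𝔭 ∤ 3` (Ireland–Rosen, Ch. 9 §3: `{1, ω, ω²}` is a subgroup of order `3` of
`(D/πD)ˣ`). [cite: IrelandRosen1982, Ch. 9 §3, remark before Prop. 9.3.2] -/
theorem three_dvd_residueCard_sub_one {𝔭 : HeightOneSpectrum (𝓞 K)} (h3 : (3 : 𝓞 K) ∉ 𝔭.asIdeal) :
    3 ∣ 𝔭.residueCard - 1 := by
  letI := Ideal.Quotient.field 𝔭.asIdeal
  have hu := (isPrimitiveRoot_mk_of_three_not_mem hζ h3).isUnit (by norm_num)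
  have hprim : IsPrimitiveRoot hu.unit 3 :=
    IsPrimitiveRoot.coe_units_iff.1
      (by simpa only [IsUnit.unit_spec] using isPrimitiveRoot_mk_of_three_not_mem hζ h3)
  have h := orderOf_dvd_natCard hu.unit
  rwa [← hprim.eq_orderOf, Nat.card_units, ← HeightOneSpectrum.residueCard_eq_card_quotient] at h

/-- For `𝔭 ∤ 3` the exponent `(N𝔭 - 1)/3` is nonzero. [folklore] -/
theorem residueCard_sub_one_div_three_ne_zero {𝔭 : HeightOneSpectrum (𝓞 K)}
    (h3 : (3 : 𝓞 K) ∉ 𝔭.asIdeal) : (𝔭.residueCard - 1) / 3 ≠ 0 := by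
  have h1 := 𝔭.one_lt_residueCard
  have h := Nat.le_of_dvd (by omega) (three_dvd_residueCard_sub_one hζ h3)
  exact (Nat.div_pos h (by norm_num)).ne'

/-- Fermat in the residue field (Ireland–Rosen Prop. 9.3.1), cubed form: for `𝔭 ∤ 3` and
`a ≢ 0`, `(a^{(N𝔭-1)/3})³ = a^{N𝔭-1} = 1`. [cite: IrelandRosen1982, Ch. 9 §3, Prop. 9.3.1] -/
theorem pow_residueCard_sub_one_div_three_pow_three {𝔭 : HeightOneSpectrum (𝓞 K)}
    (h3 : (3 : 𝓞 K) ∉ 𝔭.asIdeal) {a : 𝓞 K ⧸ 𝔭.asIdeal} (ha : a ≠ 0) :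
    (a ^ ((𝔭.residueCard - 1) / 3)) ^ 3 = 1 := by
  letI := Ideal.Quotient.field 𝔭.asIdeal
  letI := Fintype.ofFinite (𝓞 K ⧸ 𝔭.asIdeal)
  rw [← pow_mul, Nat.div_mul_cancel (three_dvd_residueCard_sub_one hζ h3),
    HeightOneSpectrum.residueCard_eq_card_quotient, Nat.card_eq_fintype_card]
  exact FiniteField.pow_card_sub_one_eq_one a ha

/-- Ireland–Rosen Prop. 9.3.2, existence: for `𝔭 ∤ 3`, `a ≢ 0` there is `m < 3` with
`a^{(N𝔭-1)/3} ≡ ζ^m (mod 𝔭)`. [cite: IrelandRosen1982, Ch. 9 §3, Prop. 9.3.2] -/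
theorem exists_mk_pow_eq_pow_residueCard_sub_one_div_three {𝔭 : HeightOneSpectrum (𝓞 K)}
    (h3 : (3 : 𝓞 K) ∉ 𝔭.asIdeal) {a : 𝓞 K ⧸ 𝔭.asIdeal} (ha : a ≠ 0) :
    ∃ i < 3, Ideal.Quotient.mk 𝔭.asIdeal (ζ ^ i) = a ^ ((𝔭.residueCard - 1) / 3) := by
  obtain ⟨i, hi, h⟩ := (isPrimitiveRoot_mk_of_three_not_mem hζ h3).eq_pow_of_pow_eq_one
    (pow_residueCard_sub_one_div_three_pow_three hζ h3 ha)
  exact ⟨i, hi, by rwa [map_pow]⟩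

/-- Evaluation: if `ζ^i ≡ a^{(N𝔭-1)/3} (mod 𝔭)` (`𝔭 ∤ 3`, `i < 3`) then `χ_𝔭(a) = ζ^i` — the other two
summands vanish because `1, ζ, ζ²` are distinct mod `𝔭` (Ireland–Rosen Prop. 9.3.2, uniqueness).
[cite: IrelandRosen1982, Ch. 9 §3, Prop. 9.3.2] -/
theorem cubicResidueSymbol_eq_pow_of_mk_pow_eq {𝔭 : HeightOneSpectrum (𝓞 K)}
    (h3 : (3 : 𝓞 K) ∉ 𝔭.asIdeal) {a : 𝓞 K ⧸ 𝔭.asIdeal} {i : ℕ} (hi : i < 3)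
    (h : Ideal.Quotient.mk 𝔭.asIdeal (ζ ^ i) = a ^ ((𝔭.residueCard - 1) / 3)) :
    cubicResidueSymbol 𝔭 a = ζ ^ i := by
  classical
  rw [cubicResidueSymbol_eq_sum_range hζ, Finset.sum_eq_single i, if_pos h]
  · intro j hj hji
    rw [if_neg]
    intro hj'
    refine hji ((isPrimitiveRoot_mk_of_three_not_mem hζ h3).pow_inj (Finset.mem_range.1 hj) hi ?_)
    rw [← map_pow, ← map_pow, hj', h]
  · intro hi'
    exact absurd (Finset.mem_range.2 hi) hi'

/-- Uniqueness form of the definition (Ireland–Rosen Prop. 9.3.2): for `𝔭 ∤ 3`, a cube root of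
unity `μ` with `μ ≡ a^{(N𝔭-1)/3} (mod 𝔭)` IS `χ_𝔭(a)`.
[cite: IrelandRosen1982, Ch. 9 §3, Prop. 9.3.2] -/
theorem cubicResidueSymbol_eq_of_pow_three_eq_one {𝔭 : HeightOneSpectrum (𝓞 K)}
    (h3 : (3 : 𝓞 K) ∉ 𝔭.asIdeal) {a : 𝓞 K ⧸ 𝔭.asIdeal} {μ : 𝓞 K} (hμ : μ ^ 3 = 1)
    (h : Ideal.Quotient.mk 𝔭.asIdeal μ = a ^ ((𝔭.residueCard - 1) / 3)) :
    cubicResidueSymbol 𝔭 a = μ := by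
  obtain ⟨i, hi, rfl⟩ := hζ.eq_pow_of_pow_eq_one hμ
  exact cubicResidueSymbol_eq_pow_of_mk_pow_eq hζ h3 hi h

/-- For `𝔭 ∤ 3` and `a ≢ 0`: `χ_𝔭(a)³ = 1` and `χ_𝔭(a) ≡ a^{(N𝔭-1)/3} (mod 𝔭)`
(Ireland–Rosen, Definition (b) / Prop. 9.3.3 (b)). [cite: IrelandRosen1982, Ch. 9 §3, Prop. 9.3.3 (b)] -/
theorem cubicResidueSymbol_spec {𝔭 : HeightOneSpectrum (𝓞 K)} (h3 : (3 : 𝓞 K) ∉ 𝔭.asIdeal)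
    {a : 𝓞 K ⧸ 𝔭.asIdeal} (ha : a ≠ 0) :
    cubicResidueSymbol 𝔭 a ^ 3 = 1 ∧
      Ideal.Quotient.mk 𝔭.asIdeal (cubicResidueSymbol 𝔭 a) = a ^ ((𝔭.residueCard - 1) / 3) := by
  obtain ⟨i, hi, h⟩ := exists_mk_pow_eq_pow_residueCard_sub_one_div_three hζ h3 ha
  rw [cubicResidueSymbol_eq_pow_of_mk_pow_eq hζ h3 hi h]
  exact ⟨by rw [← pow_mul, mul_comm, pow_mul, hζ.pow_eq_one, one_pow], h⟩

/-- **Ireland–Rosen's definition as a characterisation.** For `𝔭 ∤ 3` and `a ≢ 0 (mod 𝔭)`,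
`χ_𝔭(a) = μ` iff `μ` is a cube root of unity with `μ ≡ a^{(N𝔭-1)/3} (mod 𝔭)`.
[cite: IrelandRosen1982, Ch. 9 §3, Definition after Prop. 9.3.2] -/
theorem cubicResidueSymbol_eq_iff {𝔭 : HeightOneSpectrum (𝓞 K)} (h3 : (3 : 𝓞 K) ∉ 𝔭.asIdeal)
    {a : 𝓞 K ⧸ 𝔭.asIdeal} (ha : a ≠ 0) {μ : 𝓞 K} :
    cubicResidueSymbol 𝔭 a = μ ↔
      μ ^ 3 = 1 ∧ Ideal.Quotient.mk 𝔭.asIdeal μ = a ^ ((𝔭.residueCard - 1) / 3) :=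
  ⟨fun h => h ▸ cubicResidueSymbol_spec hζ h3 ha,
    fun h => cubicResidueSymbol_eq_of_pow_three_eq_one hζ h3 h.1 h.2⟩

/-- `χ_𝔭(0) = 0` for `𝔭 ∤ 3` (Ireland–Rosen, Definition (a)): `0^{(N𝔭-1)/3} = 0` is not congruent
to a unit. [cite: IrelandRosen1982, Ch. 9 §3, Definition after Prop. 9.3.2] -/
theorem cubicResidueSymbol_zero_of_three_not_mem {𝔭 : HeightOneSpectrum (𝓞 K)}
    (h3 : (3 : 𝓞 K) ∉ 𝔭.asIdeal) : cubicResidueSymbol 𝔭 0 = 0 := by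
  classical
  rw [cubicResidueSymbol_eq_sum_range hζ]
  refine Finset.sum_eq_zero fun j _ => if_neg ?_
  rw [zero_pow (residueCard_sub_one_div_three_ne_zero hζ h3), map_pow]
  exact pow_ne_zero _ ((isPrimitiveRoot_mk_of_three_not_mem hζ h3).ne_zero (by norm_num))

/-- The junk value: if `𝔭 ∣ 3` then `χ_𝔭 = 0` identically (all cube roots of unity are `≡ 1`, and
`1 + ζ + ζ² = 0`). Ireland–Rosen leave `(·/π)₃` undefined for `Nπ = 3`. [folklore] -/
theorem cubicResidueSymbol_of_three_mem {𝔭 : HeightOneSpectrum (𝓞 K)}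
    (h3 : (3 : 𝓞 K) ∈ 𝔭.asIdeal) (a : 𝓞 K ⧸ 𝔭.asIdeal) : cubicResidueSymbol 𝔭 a = 0 := by
  classical
  rw [cubicResidueSymbol_eq_sum_range hζ]
  have h1 : Ideal.Quotient.mk 𝔭.asIdeal ζ = 1 := (mk_eq_one_iff_three_mem hζ 𝔭).2 h3
  simp_rw [map_pow, h1, one_pow]
  by_cases h : (1 : 𝓞 K ⧸ 𝔭.asIdeal) = a ^ ((𝔭.residueCard - 1) / 3)
  · simp_rw [if_pos h]
    exact hζ.geom_sum_eq_zero (by norm_num)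
  · simp_rw [if_neg h, Finset.sum_const_zero]

/-- `χ_𝔭(0) = 0` at every finite place (Ireland–Rosen, Definition (a); and the junk value at `𝔭 ∣ 3`).
[cite: IrelandRosen1982, Ch. 9 §3, Definition after Prop. 9.3.2] -/
theorem cubicResidueSymbol_zero (𝔭 : HeightOneSpectrum (𝓞 K)) : cubicResidueSymbol 𝔭 0 = 0 := by
  by_cases h3 : (3 : 𝓞 K) ∈ 𝔭.asIdeal
  · exact cubicResidueSymbol_of_three_mem hζ h3 0
  · exact cubicResidueSymbol_zero_of_three_not_mem hζ h3

/-- `χ_𝔭(1) = 1` for `𝔭 ∤ 3`. [cite: IrelandRosen1982, Ch. 9 §3, Prop. 9.3.3] -/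
theorem cubicResidueSymbol_one {𝔭 : HeightOneSpectrum (𝓞 K)} (h3 : (3 : 𝓞 K) ∉ 𝔭.asIdeal) :
    cubicResidueSymbol 𝔭 1 = 1 :=
  cubicResidueSymbol_eq_of_pow_three_eq_one hζ h3 (one_pow 3) (by rw [map_one, one_pow])

/-- **Multiplicativity** `χ_𝔭(ab) = χ_𝔭(a) χ_𝔭(b)` (Ireland–Rosen Prop. 9.3.3 (c)); at `𝔭 ∣ 3` both
sides are `0`. [cite: IrelandRosen1982, Ch. 9 §3, Prop. 9.3.3 (c)] -/
theorem cubicResidueSymbol_mul (𝔭 : HeightOneSpectrum (𝓞 K)) (a b : 𝓞 K ⧸ 𝔭.asIdeal) :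
    cubicResidueSymbol 𝔭 (a * b) = cubicResidueSymbol 𝔭 a * cubicResidueSymbol 𝔭 b := by
  by_cases h3 : (3 : 𝓞 K) ∈ 𝔭.asIdeal
  · simp only [cubicResidueSymbol_of_three_mem hζ h3, mul_zero]
  rcases eq_or_ne a 0 with rfl | ha
  · rw [zero_mul, cubicResidueSymbol_zero hζ, zero_mul]
  rcases eq_or_ne b 0 with rfl | hb
  · rw [mul_zero, cubicResidueSymbol_zero hζ, mul_zero]
  obtain ⟨ha3, ham⟩ := cubicResidueSymbol_spec hζ h3 ha
  obtain ⟨hb3, hbm⟩ := cubicResidueSymbol_spec hζ h3 hb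
  exact cubicResidueSymbol_eq_of_pow_three_eq_one hζ h3 (by rw [mul_pow, ha3, hb3, one_mul])
    (by rw [map_mul, ham, hbm, mul_pow])

/-- `χ_𝔭(a) ≠ 0 ↔ 𝔭 ∤ 3 ∧ a ≢ 0`. [folklore] -/
theorem cubicResidueSymbol_ne_zero_iff {𝔭 : HeightOneSpectrum (𝓞 K)} {a : 𝓞 K ⧸ 𝔭.asIdeal} :
    cubicResidueSymbol 𝔭 a ≠ 0 ↔ (3 : 𝓞 K) ∉ 𝔭.asIdeal ∧ a ≠ 0 := by
  constructor
  · intro h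
    refine ⟨fun h3 => h (cubicResidueSymbol_of_three_mem hζ h3 a), ?_⟩
    rintro rfl
    exact h (cubicResidueSymbol_zero hζ 𝔭)
  · rintro ⟨h3, ha⟩ h0
    have h1 := (cubicResidueSymbol_spec hζ h3 ha).1
    rw [h0] at h1
    norm_num at h1

/-- `χ_𝔭(a)` is `0` or a cube root of unity. [cite: IrelandRosen1982, Ch. 9 §3, Definition after Prop. 9.3.2] -/
theorem cubicResidueSymbol_eq_zero_or_pow_three (𝔭 : HeightOneSpectrum (𝓞 K))
    (a : 𝓞 K ⧸ 𝔭.asIdeal) : cubicResidueSymbol 𝔭 a = 0 ∨ cubicResidueSymbol 𝔭 a ^ 3 = 1 := by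
  by_cases h : cubicResidueSymbol 𝔭 a = 0
  · exact Or.inl h
  · obtain ⟨h3, ha⟩ := (cubicResidueSymbol_ne_zero_iff hζ).1 h
    exact Or.inr (cubicResidueSymbol_spec hζ h3 ha).1

/-- The values of `χ_𝔭` lie in `{0, 1, ζ, ζ²}`. [cite: IrelandRosen1982, Ch. 9 §3, Definition after Prop. 9.3.2] -/
theorem cubicResidueSymbol_mem (𝔭 : HeightOneSpectrum (𝓞 K)) (a : 𝓞 K ⧸ 𝔭.asIdeal) :
    cubicResidueSymbol 𝔭 a = 0 ∨ cubicResidueSymbol 𝔭 a = 1 ∨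
      cubicResidueSymbol 𝔭 a = ζ ∨ cubicResidueSymbol 𝔭 a = ζ ^ 2 := by
  by_cases h3 : (3 : 𝓞 K) ∈ 𝔭.asIdeal
  · exact Or.inl (cubicResidueSymbol_of_three_mem hζ h3 a)
  rcases eq_or_ne a 0 with rfl | ha
  · exact Or.inl (cubicResidueSymbol_zero_of_three_not_mem hζ h3)
  obtain ⟨i, hi, h⟩ := exists_mk_pow_eq_pow_residueCard_sub_one_div_three hζ h3 ha
  rw [cubicResidueSymbol_eq_pow_of_mk_pow_eq hζ h3 hi h]
  interval_cases i
  · exact Or.inr (Or.inl (pow_zero ζ))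
  · exact Or.inr (Or.inr (Or.inl (pow_one ζ)))
  · exact Or.inr (Or.inr (Or.inr rfl))

/-- `χ_𝔭(a) ≡ 1 (mod (1 - ζ))` for `𝔭 ∤ 3` and `a ≢ 0`: `χ_𝔭(a) = ζ^i` and `1 - ζ ∣ 1 - ζ^i`.
This is the congruence behind the branch-point calibration of the route `PicardBranchPoint`. [folklore] -/
theorem cubicResidueSymbol_sub_one_mem_span {𝔭 : HeightOneSpectrum (𝓞 K)}
    (h3 : (3 : 𝓞 K) ∉ 𝔭.asIdeal) {a : 𝓞 K ⧸ 𝔭.asIdeal} (ha : a ≠ 0) :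
    cubicResidueSymbol 𝔭 a - 1 ∈ Ideal.span {1 - ζ} := by
  obtain ⟨i, hi, h⟩ := exists_mk_pow_eq_pow_residueCard_sub_one_div_three hζ h3 ha
  rw [cubicResidueSymbol_eq_pow_of_mk_pow_eq hζ h3 hi h, Ideal.mem_span_singleton]
  have hd := one_sub_dvd_one_sub_pow ζ i
  rwa [← dvd_neg, neg_sub] at hd

/-- `χ_𝔭(a²) = χ_𝔭(a)²`. [cite: IrelandRosen1982, Ch. 9 §3, Prop. 9.3.3 (c)] -/
theorem cubicResidueSymbol_sq (𝔭 : HeightOneSpectrum (𝓞 K)) (a : 𝓞 K ⧸ 𝔭.asIdeal) :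
    cubicResidueSymbol 𝔭 (a ^ 2) = cubicResidueSymbol 𝔭 a ^ 2 := by
  rw [sq, sq, cubicResidueSymbol_mul hζ]

/-- **Complex conjugation** (Ireland–Rosen Prop. 9.3.4 (a)): under any ring homomorphism
`σ : 𝓞 K →+* ℂ` (e.g. a complex embedding of `K` restricted to `𝓞 K`),
`conj σ(χ_𝔭(a)) = σ(χ_𝔭(a))² = σ(χ_𝔭(a²))` — a cube root of unity in `ℂ` has conjugate equal to its
square. [cite: IrelandRosen1982, Ch. 9 §3, Prop. 9.3.4 (a)] -/
theorem starRingEnd_map_cubicResidueSymbol (σ : 𝓞 K →+* ℂ) (𝔭 : HeightOneSpectrum (𝓞 K))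
    (a : 𝓞 K ⧸ 𝔭.asIdeal) :
    starRingEnd ℂ (σ (cubicResidueSymbol 𝔭 a)) = σ (cubicResidueSymbol 𝔭 a) ^ 2 := by
  rcases cubicResidueSymbol_eq_zero_or_pow_three hζ 𝔭 a with h | h
  · simp [h]
  · have hz3 : σ (cubicResidueSymbol 𝔭 a) ^ 3 = 1 := by rw [← map_pow, h, map_one]
    have hnorm : ‖σ (cubicResidueSymbol 𝔭 a)‖ = 1 :=
      Complex.norm_eq_one_of_pow_eq_one hz3 (by norm_num)
    rw [← Complex.inv_eq_conj hnorm]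
    have hmul : σ (cubicResidueSymbol 𝔭 a) ^ 2 * σ (cubicResidueSymbol 𝔭 a) = 1 := by
      rw [← hz3]; ring
    exact (eq_inv_of_mul_eq_one_left hmul).symm

/-- Prop. 9.3.4 (a), second form: `conj σ(χ_𝔭(a)) = σ(χ_𝔭(a²))`.
[cite: IrelandRosen1982, Ch. 9 §3, Prop. 9.3.4 (a)] -/
theorem starRingEnd_map_cubicResidueSymbol_eq_map_sq (σ : 𝓞 K →+* ℂ)
    (𝔭 : HeightOneSpectrum (𝓞 K)) (a : 𝓞 K ⧸ 𝔭.asIdeal) :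
    starRingEnd ℂ (σ (cubicResidueSymbol 𝔭 a)) = σ (cubicResidueSymbol 𝔭 (a ^ 2)) := by
  rw [starRingEnd_map_cubicResidueSymbol hζ, cubicResidueSymbol_sq hζ, map_pow]

/-- For `𝔭 ∤ 3`, the cubic residue symbol as a **multiplicative character** of the residue field
`𝓞 K ⧸ 𝔭` with values in `𝓞 K = ℤ[ω]` (Ireland–Rosen, Ch. 9 §3: "we may consider `χ_π` as a cubic
character on `D/πD` in the sense of Chapter 8"). The witness `hζ` only certifies that `𝓞 K`
contains the cube roots of unity; the character does not depend on it (`cubicResidueChar_apply`).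
[cite: IrelandRosen1982, Ch. 9 §3, Prop. 9.3.3] -/
noncomputable def cubicResidueChar (𝔭 : HeightOneSpectrum (𝓞 K)) (h3 : (3 : 𝓞 K) ∉ 𝔭.asIdeal) :
    MulChar (𝓞 K ⧸ 𝔭.asIdeal) (𝓞 K) where
  toFun := cubicResidueSymbol 𝔭
  map_one' := cubicResidueSymbol_one hζ h3
  map_mul' := cubicResidueSymbol_mul hζ 𝔭
  map_nonunit' a ha := by
    letI := Ideal.Quotient.field 𝔭.asIdeal
    rw [isUnit_iff_ne_zero, ne_eq, not_not] at ha
    rw [ha, cubicResidueSymbol_zero hζ]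

/-- `cubicResidueChar hζ 𝔭 h3 a = cubicResidueSymbol 𝔭 a`. [folklore] -/
@[simp] theorem cubicResidueChar_apply {𝔭 : HeightOneSpectrum (𝓞 K)} (h3 : (3 : 𝓞 K) ∉ 𝔭.asIdeal)
    (a : 𝓞 K ⧸ 𝔭.asIdeal) : cubicResidueChar hζ 𝔭 h3 a = cubicResidueSymbol 𝔭 a :=
  rfl

/-- The cubic residue character is cubic: `χ_𝔭³ = 1`. [folklore] -/
theorem cubicResidueChar_pow_three {𝔭 : HeightOneSpectrum (𝓞 K)} (h3 : (3 : 𝓞 K) ∉ 𝔭.asIdeal) :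
    cubicResidueChar hζ 𝔭 h3 ^ 3 = 1 := by
  refine MulChar.ext fun u => ?_
  rw [MulChar.pow_apply_coe, MulChar.one_apply_coe, cubicResidueChar_apply]
  exact (cubicResidueSymbol_spec hζ h3 (Units.ne_zero u)).1

/-- **Branch-point congruence** (elementary form): for `𝔭 ∤ 3`, a nonzero polynomial `g` over the
residue field and any primitive cube root `ζ`,
`-Σ_x χ_𝔭(g(x)) ≡ #{x : g(x) = 0} - 1 (mod 1 - ζ)`. Proof: `χ_𝔭(g x) ≡ 1` if `g x ≠ 0` and `= 0`
otherwise, so `Σ_x χ_𝔭(g x) ≡ N𝔭 - #roots ≡ 1 - #roots`, as `3 ∈ (1 - ζ)` and `3 ∣ N𝔭 - 1`.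
[folklore] -/
theorem neg_sum_cubicResidueSymbol_eval_sub_mem_span {𝔭 : HeightOneSpectrum (𝓞 K)}
    (h3 : (3 : 𝓞 K) ∉ 𝔭.asIdeal) [Fintype (𝓞 K ⧸ 𝔭.asIdeal)] [DecidableEq (𝓞 K ⧸ 𝔭.asIdeal)]
    {g : (𝓞 K ⧸ 𝔭.asIdeal)[X]} (hg : g ≠ 0) :
    -(∑ x, cubicResidueSymbol 𝔭 (g.eval x)) - ((g.roots.toFinset.card : 𝓞 K) - 1) ∈
      Ideal.span {1 - ζ} := by
  classical
  -- each term: `χ(g x) + [g x = 0] ≡ 1 (mod 1 - ζ)`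
  have hterm : ∀ x : 𝓞 K ⧸ 𝔭.asIdeal, cubicResidueSymbol 𝔭 (g.eval x) +
      (if x ∈ g.roots.toFinset then (1 : 𝓞 K) else 0) - 1 ∈ Ideal.span {1 - ζ} := by
    intro x
    by_cases hx : g.eval x = 0
    · have hmem : x ∈ g.roots.toFinset := by
        rw [Multiset.mem_toFinset, mem_roots hg]
        exact hx
      rw [if_pos hmem, hx, cubicResidueSymbol_zero hζ, zero_add, sub_self]
      exact Ideal.zero_mem _
    · have hmem : x ∉ g.roots.toFinset := by
        rw [Multiset.mem_toFinset, mem_roots hg]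
        exact hx
      rw [if_neg hmem, add_zero]
      exact cubicResidueSymbol_sub_one_mem_span hζ h3 hx
  have hsum : ∑ x, (cubicResidueSymbol 𝔭 (g.eval x) +
      (if x ∈ g.roots.toFinset then (1 : 𝓞 K) else 0) - 1) ∈ Ideal.span {1 - ζ} :=
    Ideal.sum_mem _ fun x _ => hterm x
  have hcount : ∑ x, (if x ∈ g.roots.toFinset then (1 : 𝓞 K) else 0) = g.roots.toFinset.card := by
    rw [Finset.sum_ite_mem, Finset.univ_inter, Finset.sum_const, nsmul_eq_mul, mul_one]
  have hexp : ∑ x, (cubicResidueSymbol 𝔭 (g.eval x) +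
      (if x ∈ g.roots.toFinset then (1 : 𝓞 K) else 0) - 1) =
      ∑ x, cubicResidueSymbol 𝔭 (g.eval x) + g.roots.toFinset.card - 𝔭.residueCard := by
    rw [Finset.sum_sub_distrib, Finset.sum_add_distrib, hcount, Finset.sum_const, Finset.card_univ,
      nsmul_eq_mul, mul_one, ← Nat.card_eq_fintype_card,
      ← HeightOneSpectrum.residueCard_eq_card_quotient]
  rw [hexp] at hsum
  -- `N𝔭 ≡ 1 (mod 1 - ζ)` since `3 ∣ N𝔭 - 1` and `3 ∈ (1 - ζ)`
  have hq : (𝔭.residueCard : 𝓞 K) - 1 ∈ Ideal.span {1 - ζ} := by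
    obtain ⟨c, hc⟩ := three_dvd_residueCard_sub_one hζ h3
    have h1 := 𝔭.one_lt_residueCard
    have hq3 : 𝔭.residueCard = 3 * c + 1 := by omega
    have : (𝔭.residueCard : 𝓞 K) - 1 = 3 * c := by
      rw [hq3]
      push_cast
      ring
    rw [this]
    exact Ideal.mul_mem_right _ _ (three_mem_span_one_sub hζ)
  have hfin := Ideal.add_mem _ hsum hq
  rw [← Ideal.neg_mem_iff] at hfin
  convert hfin using 1
  ring

end IsPrimitiveRoot

section Embeddings

/-! ### The two complex embeddings of `ℚ(ω)` are conjugate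

Stated for an abstract `K` with `IsCyclotomicExtension {3} ℚ K` as a hypothesis (no instance
diamond there). At the concrete field write
`haveI : IsCyclotomicExtension {3} ℚ (CyclotomicField 3 ℚ) := CyclotomicField.isCyclotomicExtension 3 ℚ`
first (see `exists_isPrimitiveRoot_three_cyclotomicField`). -/

/-- `ℚ(ω)` has a single infinite place: any two complex embeddings are equal or complex conjugate
(`0` real places, `φ(3)/2 = 1` complex place). [folklore] -/
theorem embedding_eq_or_conjugate_eq [IsCyclotomicExtension {3} ℚ K] (φ ψ : K →+* ℂ) :
    φ = ψ ∨ NumberField.ComplexEmbedding.conjugate φ = ψ := by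
  have hcard : Fintype.card (NumberField.InfinitePlace K) = 1 := by
    rw [NumberField.InfinitePlace.card_eq_nrRealPlaces_add_nrComplexPlaces,
      IsCyclotomicExtension.Rat.nrRealPlaces_eq_zero K (by norm_num : 2 < 3),
      IsCyclotomicExtension.Rat.nrComplexPlaces_eq_totient_div_two 3,
      Nat.totient_prime Nat.prime_three]
  have hsub : Subsingleton (NumberField.InfinitePlace K) :=
    Fintype.card_le_one_iff_subsingleton.1 hcard.le
  exact NumberField.InfinitePlace.mk_eq_iff.1 (Subsingleton.elim _ _)

/-- Hence the values of two DISTINCT complex embeddings of `ℚ(ω)` are complex conjugate — in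
particular the two complex values of `χ_𝔭(a)` and of the Picard trace `a_𝔭(f)` (Ireland–Rosen
Prop. 9.3.4). [cite: IrelandRosen1982, Ch. 9 §3, Prop. 9.3.4] -/
theorem embedding_apply_eq_starRingEnd_of_ne [IsCyclotomicExtension {3} ℚ K] {φ ψ : K →+* ℂ}
    (h : φ ≠ ψ) (x : K) : ψ x = starRingEnd ℂ (φ x) := by
  rcases embedding_eq_or_conjugate_eq φ ψ with rfl | h'
  · exact absurd rfl h
  · rw [← h', NumberField.ComplexEmbedding.conjugate_coe_eq]

end Embeddings

/-- **Independence of the choice of `ω` (route form).** For every `ζ : 𝓞 K` with `ζ² + ζ + 1 = 0`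
the expression inlined by `Summits/Langlands/Langlands/Theses/PicardBranchPoint`,
`Σ_{j<3} (if ζ^j ≡ a^{(N𝔭-1)/3} (mod 𝔭) then ζ^j else 0)`, equals `cubicResidueSymbol 𝔭 a`; in
particular it does not depend on `ζ`. [folklore] -/
theorem sum_range_ite_eq_cubicResidueSymbol {ζ : 𝓞 K} (hζ : ζ ^ 2 + ζ + 1 = 0)
    (𝔭 : HeightOneSpectrum (𝓞 K)) (a : 𝓞 K ⧸ 𝔭.asIdeal)
    [∀ j : ℕ, Decidable (Ideal.Quotient.mk 𝔭.asIdeal (ζ ^ j) = a ^ ((𝔭.residueCard - 1) / 3))] :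
    (∑ j ∈ Finset.range 3,
      (if Ideal.Quotient.mk 𝔭.asIdeal (ζ ^ j) = a ^ ((𝔭.residueCard - 1) / 3) then ζ ^ j else 0)) =
      cubicResidueSymbol 𝔭 a :=
  (cubicResidueSymbol_eq_sum_range (isPrimitiveRoot_of_sq_add_self_add_one hζ) 𝔭 a).symm

/-! ### The Picard trace `a_𝔭(f) = -Σ_x χ_𝔭(f̄(x))` -/

/-- The **Picard trace** of `f ∈ ℤ[X]` at a finite place `𝔭` of `K` (`= ℚ(ω)`):
`a_𝔭(f) = -Σ_{x ∈ 𝓞 K ⧸ 𝔭} χ_𝔭(f̄(x))`, `f̄ = f mod 𝔭`, the cubic character sum `-S_χ` of the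
Picard curve `C : y³ = f(x)`. For `deg f = 4` (one point at infinity) and `𝔭 ∤ 3`, counting
`y` with `y³ = f̄(x)` by Ireland–Rosen Prop. 8.1.5 (`N(y³ = a) = 1 + χ(a) + χ̄(a)` for `a ≠ 0`)
gives `#C(𝓞 K ⧸ 𝔭) = N𝔭 + 1 + S_χ + S_χ̄`, so `a_𝔭(f)` is the trace of geometric Frobenius on the
`χ`-isotypic half of `H¹(C)`; this is the convention of route `PicardBranchPoint`
(`neg_finsum_sum_range_ite_eq_picardTrace`). Written with `∑ᶠ` (the residue ring is finite:
`picardTrace_eq_neg_sum`); `0` at `𝔭 ∣ 3` (`picardTrace_of_three_mem`).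
[cite: IrelandRosen1982, Ch. 8 §1, Prop. 8.1.5] -/
noncomputable def picardTrace (f : ℤ[X]) (𝔭 : HeightOneSpectrum (𝓞 K)) : 𝓞 K :=
  -(∑ᶠ x : 𝓞 K ⧸ 𝔭.asIdeal,
      cubicResidueSymbol 𝔭
        ((f.map ((Ideal.Quotient.mk 𝔭.asIdeal).comp (algebraMap ℤ (𝓞 K)))).eval x))

/-- `picardTrace` as a `Fintype` sum. [folklore] -/
theorem picardTrace_eq_neg_sum (f : ℤ[X]) (𝔭 : HeightOneSpectrum (𝓞 K))
    [Fintype (𝓞 K ⧸ 𝔭.asIdeal)] :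
    picardTrace f 𝔭 = -∑ x : 𝓞 K ⧸ 𝔭.asIdeal,
      cubicResidueSymbol 𝔭
        ((f.map ((Ideal.Quotient.mk 𝔭.asIdeal).comp (algebraMap ℤ (𝓞 K)))).eval x) := by
  rw [picardTrace, finsum_eq_sum_of_fintype]

/-- **Route bridge.** For every `ζ : 𝓞 K` with `ζ² + ζ + 1 = 0`, the expression inlined in the
items of `Summits/Langlands/Langlands/Theses/PicardBranchPoint`,
`-(∑ᶠ x, Σ_{j<3} (if ζ^j ≡ f̄(x)^{(N𝔭-1)/3} (mod 𝔭) then ζ^j else 0))`, equals `picardTrace f 𝔭`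
(any family of `Decidable` instances, in particular the classical ones). [folklore] -/
theorem neg_finsum_sum_range_ite_eq_picardTrace {ζ : 𝓞 K} (hζ : ζ ^ 2 + ζ + 1 = 0) (f : ℤ[X])
    (𝔭 : HeightOneSpectrum (𝓞 K))
    [∀ (x : 𝓞 K ⧸ 𝔭.asIdeal) (j : ℕ), Decidable (Ideal.Quotient.mk 𝔭.asIdeal (ζ ^ j) =
      (f.map ((Ideal.Quotient.mk 𝔭.asIdeal).comp (algebraMap ℤ (𝓞 K)))).eval x ^
        ((𝔭.residueCard - 1) / 3))] :
    -(∑ᶠ x : 𝓞 K ⧸ 𝔭.asIdeal, ∑ j ∈ Finset.range 3,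
        (if Ideal.Quotient.mk 𝔭.asIdeal (ζ ^ j) =
            (f.map ((Ideal.Quotient.mk 𝔭.asIdeal).comp (algebraMap ℤ (𝓞 K)))).eval x ^
              ((𝔭.residueCard - 1) / 3)
          then ζ ^ j else 0)) = picardTrace f 𝔭 := by
  unfold picardTrace
  congr 1
  exact finsum_congr fun x => sum_range_ite_eq_cubicResidueSymbol hζ 𝔭 _

/-- `picardTrace f 𝔭 = 0` at `𝔭 ∣ 3` (junk value inherited from `cubicResidueSymbol`), given that
`𝓞 K` contains a primitive cube root of unity. [folklore] -/
theorem picardTrace_of_three_mem {ζ : 𝓞 K} (hζ : IsPrimitiveRoot ζ 3) (f : ℤ[X])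
    {𝔭 : HeightOneSpectrum (𝓞 K)} (h3 : (3 : 𝓞 K) ∈ 𝔭.asIdeal) : picardTrace f 𝔭 = 0 := by
  simp only [picardTrace, cubicResidueSymbol_of_three_mem hζ h3, finsum_zero, neg_zero]

/-- **Branch-point congruence** for the Picard trace: for `𝔭 ∤ 3`, `f̄ ≠ 0` and any primitive cube
root `ζ`, `a_𝔭(f) ≡ #{x ∈ 𝓞 K ⧸ 𝔭 : f̄(x) = 0} - 1 (mod 1 - ζ)` — the elementary shadow of
"`J(C)[1 - ω]` is the branch-point module" used by route `PicardBranchPoint` to calibrate the sign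
of `a_𝔭`. Immediate from `neg_sum_cubicResidueSymbol_eval_sub_mem_span`. [folklore] -/
theorem picardTrace_sub_card_roots_sub_one_mem_span {ζ : 𝓞 K} (hζ : IsPrimitiveRoot ζ 3) (f : ℤ[X])
    {𝔭 : HeightOneSpectrum (𝓞 K)} [DecidableEq (𝓞 K ⧸ 𝔭.asIdeal)] (h3 : (3 : 𝓞 K) ∉ 𝔭.asIdeal)
    (hf : f.map ((Ideal.Quotient.mk 𝔭.asIdeal).comp (algebraMap ℤ (𝓞 K))) ≠ 0) :
    picardTrace f 𝔭 -
        (((f.map ((Ideal.Quotient.mk 𝔭.asIdeal).comp (algebraMap ℤ (𝓞 K)))).roots.toFinset.card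
            : 𝓞 K) - 1) ∈ Ideal.span {1 - ζ} := by
  letI := Fintype.ofFinite (𝓞 K ⧸ 𝔭.asIdeal)
  rw [picardTrace_eq_neg_sum]
  exact neg_sum_cubicResidueSymbol_eval_sub_mem_span hζ h3 hf

end Literature.NumberTheory.GaloisRepresentations
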